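import Mathlib
import Summits.QuantumFields.YangMills.Theorems.BalabanUVNodesN13WilsonPartitionFnGaussianUpperBoundSU

/-!
# Route `CoarseStiffnessTail` — THE PARTITION-FUNCTION RATIO ON BAŁABAN's TORI: `log Z_P(β') − log Z_P(β) = O(|T|) + O((|T|/n)·log β)`
# for `0 < β' ≤ β`, `β/β'` bounded (lead's certificate, seat `ym-line-cst-p1` g14; helper on 25301, BY NAME from the N13 two-sided bounds)

THE THEOREM (`log_partitionFn_ratio_le`, `G = SU(N)`, EVERY `Params` `P` — any dimension `d`, block size, volume, cut-off — and
`1 ≤ β`, `0 < β' ≤ β`):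

  `log Z_P(β') − log Z_P(β) ≤ a(d−1)|T|·(log β − log β') + a·d·(|T|/n)·log β + ((d−1)·log(D_N T_N) + d·max(C_N, 0) + 8d²)·|T|`,

`a = (N²−1)/2`, `|T| = |T₁^{(0)}|` the number of sites of the finest torus, `n = 2L^{m+K}` its number of sites per direction,
`D_N T_N` / `C_N` the displayed one-plaquette constants of the two source files; `exists_log_partitionFn_ratio_le` is the `∃ E ≥ 0`
form with last term `E·d²·|T|`.

PROOF = TWO TREE THEOREMS SUBTRACTED.  Upper bound at `β'`: the axial-tree comparison `log Z_P(β') ≤ (d−1)(1−1/n)|T|·log linkMass(β')`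
(`BalabanUVNodes.N13WilsonPartitionFnAxialTreeUpperBound.log_partitionFn_le_axialTree`, any `β' ≥ 0`) with the one-plaquette Laplace
bound `log linkMass_{SU(N)}(β') ≤ −a·log β' + log(D_N T_N)` (`…N13WilsonPartitionFnGaussianUpperBoundSU.log_linkMass_SU_le`, `β' > 0`).
Lower bound at `β`: the layered Faddeev–Popov bound `log Z_P(β) ≥ −((d−1) + 1/n)|T|·(a·log β + C_N) − 8d²|T|`
(`…N13GaugeFixingAxialLayers.log_partitionFn_ge_axialLayers_specialUnitary`, `β ≥ 1`).  The Gaussian powers `a(d−1)|T|·log(·)` of the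
two sides CANCEL up to the boundary layers (`1/n` of each comb), leaving `a(d−1)|T|·log(β/β')` + the layer term `a·d·(|T|/n)·log β` +
`O(|T|)`; the bookkeeping is one `ring` identity exhibiting the difference as a sum of non-negative terms.

WHY IT IS RECORDED HERE (line card `Cruxes/CappedCoarseStiffnessL/Lines/birth.md` §g14).  Every exponential moment of the Wilson ACTION under
the Gibbs law is such a ratio (`CoarseStiffnessTailPressureConvexity.integral_exp_mul_action_eq`: `∫e^{tA}dGibbs_β = Z(β − t)/Z(β)`), so this
file is the whole analytic input of the companion `…LBareCompactCoupling`: the bare (`j = 0`) faces of the crux `CappedCoarseStiffnessL`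
(25301) and of its BULK stub hold with TOTAL logarithmic slack `(3/2)·(#Plaq_0/n_K)·log β_K` — vanishing per plaquette along `K → ∞` —
hence uniformly in the cut-off and the volume on every compact range of couplings.  The seat's g2 memo predicted exactly this shape
(«any bond-elimination sandwich leaves `O(log β_K)`·(boundary) »); the two halves of the sandwich were landed today by the N13 seats
(`pub-ymgap-dag-n13-w1/w3`), for `d = 4` purposes, over the shared `Params`/`partitionFn` vocabulary — nothing of them is re-proved here.

HONEST SCOPE.  Elementary (real arithmetic on two landed bounds); nothing of Bałaban's estimates is asserted; the `γ → 0` corner at fixed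
lattice (where `(|T|/n)·log β ≫ |T|`) is NOT controlled — that is the uniform-Laplace-exponent regime of the g2/g12 memos.  The crux 25301,
its stubs, `HistoryTailL` 19936 stay OPEN; `YM3TorusSU2` (R3, RECORD rung, not Clay) is NOT proved; the Yang–Mills mass gap is NOT touched.

References (locators of the source files' citation headers): T. Bałaban, CMP **102** (1985) 255–275 [Balaban1985UV3] ((1)–(3) p.256: the
Wilson–Gibbs laws on the tori `T₁^{(0)}`); T. Bałaban, CMP **109** (1987) 249–301 [Balaban1987RG1] ((0.14)–(0.17) pp.254–255: the
one-plaquette normalisation `z`); I. Montvay, G. Münster, *Quantum Fields on a Lattice* (1994) §3.2.5 [MontvayMunster1994] (tree gauge).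
-/

noncomputable section

namespace Summit.QuantumFields.YangMills.Theorems.CoarseStiffnessTailTorusPartitionRatio

open MeasureTheory
open Literature.MathematicalPhysics.QuantumFieldTheory
open Literature.MathematicalPhysics.QuantumFieldTheory.UnitaryCayley (haarChartConst)
open Literature.MathematicalPhysics.QuantumFieldTheory.Balaban1983to89
open Literature.MathematicalPhysics.QuantumFieldTheory.Balaban1983to89.Missing
open Summit.QuantumFields.BalabanUV.T4Continuum.NE7b.BarePartitionFnDecay (linkMass)
open Summit.QuantumFields.YangMills.BalabanUVNodes.N13WilsonPartitionFnAxialTreeUpperBound (log_partitionFn_le_axialTree linkMass_pos)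
open Summit.QuantumFields.YangMills.BalabanUVNodes.N13ZNormLaplaceUpperSU (one_le_DT)
open Summit.QuantumFields.YangMills.BalabanUVNodes.N13WilsonPartitionFnGaussianUpperBoundSU (log_linkMass_SU_le)
open Summit.QuantumFields.YangMills.BalabanUVNodes.N13GaugeFixingAxialLayers (log_partitionFn_ge_axialLayers_specialUnitary)

/-! ## §1 The torus partition-function RATIO for `SU(N)`, any `Params`: the two N13 Gaussian bounds combined -/

section Ratio

variable (N : ℕ) [NeZero N]

/-- **THE PARTITION-FUNCTION RATIO ON BAŁABAN's TORI** (`G = SU(N)`, every `Params` `P`, `1 ≤ β`, `0 < β' ≤ β`):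
`log Z_P(β') − log Z_P(β) ≤ ((N²−1)/2)(d−1)|T|·log(β/β') + ((N²−1)/2)·d·(|T|/n)·log β + ((d−1)log(D_N T_N) + d·max(C_N,0) + 8d²)|T|`,
`|T| = |T₁^{(0)}|`, `n = 2L^{m+K}` sites per direction — BY NAME from the tree's axial-tree upper bound (`log_partitionFn_le_axialTree` +
`log_linkMass_SU_le`) at `β'` and the layered Faddeev–Popov lower bound (`log_partitionFn_ge_axialLayers_specialUnitary`) at `β`: the Gaussian
powers `((N²−1)/2)(d−1)|T|·log` CANCEL up to the `1/n`-boundary layers of the two combs, leaving `O(|T|) + O((|T|/n)·log β)`. [folklore] -/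
theorem log_partitionFn_ratio_le (P : Params) {β β' : ℝ} (hβ : 1 ≤ β) (hβ' : 0 < β') (hle : β' ≤ β) :
    Real.log (partitionFn (G := Matrix.specialUnitaryGroup (Fin N) ℂ) P β') -
        Real.log (partitionFn (G := Matrix.specialUnitaryGroup (Fin N) ℂ) P β) ≤
      (((N * N : ℕ) : ℝ) - 1) / 2 * ((P.d : ℝ) - 1) * (Fintype.card (Site P 0) : ℝ) * (Real.log β - Real.log β') +
        (((N * N : ℕ) : ℝ) - 1) / 2 * (P.d : ℝ) * ((Fintype.card (Site P 0) : ℝ) * (P.sitesPerDir 0 : ℝ)⁻¹) * Real.log β +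
        (((P.d : ℝ) - 1) *
              Real.log (max (Real.pi * (haarChartConst N : ℝ) * 5 ^ (N * N) *
                    (volume (Metric.closedBall (0 : EuclideanSpace ℝ (Fin N × Fin N)) 1)).toReal) (10 ^ (N * N - 1)) *
                  (∑' k : ℕ, ((k : ℝ) + 1) ^ (N * N - 1) * Real.exp (-(1 / (2 * (N : ℝ)))) ^ k)) +
            (P.d : ℝ) * max (((N * N : ℕ) : ℝ) * Real.log (16 * Real.pi + 1) + Real.log ((2 * N + 1) / (4 * Real.pi))) 0 +
            8 * (P.d : ℝ) ^ 2) * (Fintype.card (Site P 0) : ℝ) := by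
  have hU1 := log_partitionFn_le_axialTree P (G := Matrix.specialUnitaryGroup (Fin N) ℂ) hβ'.le
  have hU2 := log_linkMass_SU_le N hβ'
  have hL := log_partitionFn_ge_axialLayers_specialUnitary N P hβ
  rw [one_div] at hU1
  set a : ℝ := (((N * N : ℕ) : ℝ) - 1) / 2 with ha
  set D : ℝ := (P.d : ℝ) with hD
  set V : ℝ := (Fintype.card (Site P 0) : ℝ) with hV
  set r : ℝ := (P.sitesPerDir 0 : ℝ)⁻¹ with hr
  set LDT : ℝ := Real.log (max (Real.pi * (haarChartConst N : ℝ) * 5 ^ (N * N) *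
        (volume (Metric.closedBall (0 : EuclideanSpace ℝ (Fin N × Fin N)) 1)).toReal) (10 ^ (N * N - 1)) *
      (∑' k : ℕ, ((k : ℝ) + 1) ^ (N * N - 1) * Real.exp (-(1 / (2 * (N : ℝ)))) ^ k)) with hLDT
  set C : ℝ := ((N * N : ℕ) : ℝ) * Real.log (16 * Real.pi + 1) + Real.log ((2 * N + 1) / (4 * Real.pi)) with hC
  set lβ : ℝ := Real.log β with hlβ
  set lβ' : ℝ := Real.log β' with hlβ'
  set LM : ℝ := Real.log (linkMass (G := Matrix.specialUnitaryGroup (Fin N) ℂ) β') with hLM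
  set LZ : ℝ := Real.log (partitionFn (G := Matrix.specialUnitaryGroup (Fin N) ℂ) P β) with hLZ
  set LZ' : ℝ := Real.log (partitionFn (G := Matrix.specialUnitaryGroup (Fin N) ℂ) P β') with hLZ'
  -- signs
  have ha0 : 0 ≤ a := by
    have h1 : (1 : ℝ) ≤ ((N * N : ℕ) : ℝ) := by
      have : 1 ≤ N * N := Nat.one_le_iff_ne_zero.2 (Nat.mul_ne_zero (NeZero.ne N) (NeZero.ne N))
      exact_mod_cast this
    rw [ha]; linarith
  have hD1 : 1 ≤ D := by rw [hD]; exact_mod_cast P.hd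
  have hV0 : 0 ≤ V := by rw [hV]; exact Nat.cast_nonneg _
  have hn1 : (1 : ℝ) ≤ (P.sitesPerDir 0 : ℝ) := by exact_mod_cast Nat.pos_of_ne_zero (P.sitesPerDir_ne_zero 0)
  have hr0 : 0 ≤ r := by rw [hr]; exact inv_nonneg.2 (by linarith)
  have hr1 : r ≤ 1 := by rw [hr]; exact inv_le_one_of_one_le₀ hn1
  have hLDT0 : 0 ≤ LDT := by rw [hLDT]; exact Real.log_nonneg one_le_DT
  have hl : lβ' ≤ lβ := by rw [hlβ, hlβ']; exact Real.log_le_log hβ' hle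
  have hCM : C ≤ max C 0 := le_max_left _ _
  have hM0 : 0 ≤ max C 0 := le_max_right _ _
  -- the upper bound at `β'`
  have hcoef : 0 ≤ (D - 1) * V * (1 - r) := by
    have : 0 ≤ D - 1 := by linarith
    have : 0 ≤ 1 - r := by linarith
    positivity
  have hU : LZ' ≤ (D - 1) * V * (1 - r) * (-a * lβ' + LDT) := hU1.trans (mul_le_mul_of_nonneg_left hU2 hcoef)
  -- bookkeeping identity: claimed bound − (upper − lower) is a sum of non-negative terms
  have key : a * (D - 1) * V * (lβ - lβ') + a * D * (V * r) * lβ + ((D - 1) * LDT + D * max C 0 + 8 * D ^ 2) * V -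
      ((D - 1) * V * (1 - r) * (-a * lβ' + LDT) - (-((D - 1 + r) * V) * (a * lβ + C) - 8 * D ^ 2 * V)) =
      a * (D - 1) * r * V * (lβ - lβ') + (D - 1) * V * r * LDT + ((D - 1) * V + r * V) * (max C 0 - C) +
        (1 - r) * V * max C 0 := by ring
  have hlβ0 : 0 ≤ lβ := by rw [hlβ]; exact Real.log_nonneg hβ
  have t1 : 0 ≤ a * (D - 1) * r * V * (lβ - lβ') := by
    have : 0 ≤ D - 1 := by linarith
    have : 0 ≤ lβ - lβ' := by linarith
    positivity
  have t2 : 0 ≤ (D - 1) * V * r * LDT := by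
    have : 0 ≤ D - 1 := by linarith
    positivity
  have t3 : 0 ≤ ((D - 1) * V + r * V) * (max C 0 - C) := by
    have : 0 ≤ D - 1 := by linarith
    have : 0 ≤ max C 0 - C := by linarith
    positivity
  have t4 : 0 ≤ (1 - r) * V * max C 0 := by
    have : 0 ≤ 1 - r := by linarith
    positivity
  linarith [hU, hL, key, t1, t2, t3, t4]

/-- **∃-FORM** (the constant depends on `N` only): `∃ E ≥ 0` with
`log Z_P(β') − log Z_P(β) ≤ ((N²−1)/2)(d−1)|T|(log β − log β') + ((N²−1)/2)·d·(|T|/n)·log β + E·d²·|T|`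
for every `Params` `P`, `1 ≤ β`, `0 < β' ≤ β`. [folklore] -/
theorem exists_log_partitionFn_ratio_le :
    ∃ E : ℝ, 0 ≤ E ∧ ∀ (P : Params) (β β' : ℝ), 1 ≤ β → 0 < β' → β' ≤ β →
      Real.log (partitionFn (G := Matrix.specialUnitaryGroup (Fin N) ℂ) P β') -
          Real.log (partitionFn (G := Matrix.specialUnitaryGroup (Fin N) ℂ) P β) ≤
        (((N * N : ℕ) : ℝ) - 1) / 2 * ((P.d : ℝ) - 1) * (Fintype.card (Site P 0) : ℝ) * (Real.log β - Real.log β') +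
          (((N * N : ℕ) : ℝ) - 1) / 2 * (P.d : ℝ) * ((Fintype.card (Site P 0) : ℝ) * (P.sitesPerDir 0 : ℝ)⁻¹) * Real.log β +
          E * (P.d : ℝ) ^ 2 * (Fintype.card (Site P 0) : ℝ) := by
  set LDT : ℝ := Real.log (max (Real.pi * (haarChartConst N : ℝ) * 5 ^ (N * N) *
        (volume (Metric.closedBall (0 : EuclideanSpace ℝ (Fin N × Fin N)) 1)).toReal) (10 ^ (N * N - 1)) *
      (∑' k : ℕ, ((k : ℝ) + 1) ^ (N * N - 1) * Real.exp (-(1 / (2 * (N : ℝ)))) ^ k)) with hLDT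
  set C : ℝ := ((N * N : ℕ) : ℝ) * Real.log (16 * Real.pi + 1) + Real.log ((2 * N + 1) / (4 * Real.pi)) with hC
  have hLDT0 : 0 ≤ LDT := by rw [hLDT]; exact Real.log_nonneg one_le_DT
  have hM0 : 0 ≤ max C 0 := le_max_right _ _
  refine ⟨LDT + max C 0 + 8, by positivity, fun P β β' hβ hβ' hle => ?_⟩
  have h := log_partitionFn_ratio_le N P hβ hβ' hle
  rw [← hLDT, ← hC] at h
  have hD1 : (1 : ℝ) ≤ (P.d : ℝ) := by exact_mod_cast P.hd
  have hV0 : (0 : ℝ) ≤ (Fintype.card (Site P 0) : ℝ) := Nat.cast_nonneg _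
  have hE : (((P.d : ℝ) - 1) * LDT + (P.d : ℝ) * max C 0 + 8 * (P.d : ℝ) ^ 2) * (Fintype.card (Site P 0) : ℝ) ≤
      (LDT + max C 0 + 8) * (P.d : ℝ) ^ 2 * (Fintype.card (Site P 0) : ℝ) := by
    have hd1 : (P.d : ℝ) - 1 ≤ (P.d : ℝ) ^ 2 := by nlinarith
    have hd2 : (P.d : ℝ) ≤ (P.d : ℝ) ^ 2 := by nlinarith
    have h1 : ((P.d : ℝ) - 1) * LDT ≤ (P.d : ℝ) ^ 2 * LDT := mul_le_mul_of_nonneg_right hd1 hLDT0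
    have h2 : (P.d : ℝ) * max C 0 ≤ (P.d : ℝ) ^ 2 * max C 0 := mul_le_mul_of_nonneg_right hd2 hM0
    have h3 : ((P.d : ℝ) - 1) * LDT + (P.d : ℝ) * max C 0 + 8 * (P.d : ℝ) ^ 2 ≤ (LDT + max C 0 + 8) * (P.d : ℝ) ^ 2 := by
      nlinarith
    exact mul_le_mul_of_nonneg_right h3 hV0
  linarith

end Ratio

end Summit.QuantumFields.YangMills.Theorems.CoarseStiffnessTailTorusPartitionRatio

end
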